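/-
Copyright (c) 2026 the pub-hodgecm-mathlib formalisation cell (harness21).  Prover seat hodgecm-mathlib-K2Liu-p13 (g4), Track B «K2-LIT»,
#184♮ = hLiu418 = `stmt-HodgeConjecture-24832`; ROAD Φ (RULING «M-156n»), #41 TOP, (β) END-file brick (E10) of the census `CENSUS-Beta-EndFile.K2Liu-p13-g4.md`:
THE LOCAL BAD-PLACE FACE of the Euler-face identity — for a local factor `G_s = H_v^{2(s−s₀)}·b` of ★ (E6′) `K2LiuStdFamilyAwayPurityFlat` at an ADAPTED place
(★ (E10a) `K2LiuStdDatumFinsetAdapted`: a compact open Iwasawa `K₀ ≤ H_v` with `ι_v(K₀) ⊆ 𝒦.K`), the integrand `y ↦ G_s((w_Δ)_v·y·h)` is integrable over `N_Δ(L⁺_v)`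
(★ (E9) `K2LiuLocalSiegelSectionIntegrable`) and its integral is `aNorm 2 χ_v (ν(N_Δ∩K₀)) s · Fn s` with `Fn` `q_v`-rational, regular on `{0 < re}` (★ A7-AllS0
`normalisedRegularity_cm_allS0` moved to ★ (E3)'s currency by ★ (E10c) `exists_value_unipDeltaLoc_of_forall_haar`).
THEOREMS ONLY (no `def`, no `instance`, no named-fact hypothesis, no `sorry`).
-/
import Summits.HodgeConjecture.HodgeConjecture.Theorems.K2LiuLocalSiegelSectionIntegrable    -- ★ (E9) p862520 (+ ★ A7-AllS0, ★ (E10c))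
import Summits.HodgeConjecture.HodgeConjecture.Theorems.K2LiuStdFamilyAwayPurityFlat         -- ★ (E6′) p862350 `heightTwistLoc_siegel∕_smooth` (K2Liu-p03)
import Summits.HodgeConjecture.HodgeConjecture.Theorems.K2LiuIwasawaHeightContinuous         -- ★ `iwasawaHeight_of_mem_K`
import Summits.HodgeConjecture.HodgeConjecture.Theorems.K2LiuSiegelNormaliserTwoOfRecord     -- ★ p862117 `norm_localComponent_of_record`
import HarnessLib

/-!
# Crux `HLiu418`, ROAD Φ, organ Φ8 (row G6), brick (E10): THE LOCAL BAD-PLACE FACE `∫ G_s((w_Δ)_v y h) dν_v(y) = aNorm_v(s)·Fn(s)` WITH `Fn` `q_v`-RATIONAL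

Cell `hodgecm-mathlib`, crux item hLiu418 = `stmt-HodgeConjecture-24832` (helper lane, count-neutral).  The doubled CM datum `H = U(𝕎 ⊕ −𝕎)`, `rank 𝕎 = 2`, a STANDARD Iwasawa
datum `𝒦`, a finite place `v` of `L⁺` where `𝒦` is ADAPTED: a compact open `K₀ ≤ H(L⁺_v)` with `H_v = P_Δ(L⁺_v)·K₀` and `ι_v(K₀) ⊆ 𝒦.K` (★ (E10a)
`exists_isStd_adaptedEverywhere`).  For `b ∈ I_v(s₀, χ_v)` (★ `localDegPS`, `χ_v = (χ.localComponent ·)`, `χ = toHeckeCharacter L lam⁻¹`) the (E6′) local flat family is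
`G_s(u) := H_v(u)^{2(s−s₀)}·b(u)`, `H_v(u) = |det_Δ pPart_𝒦(ι_v u)|^{1∕2}` (★ p862350's last clause, byte for byte).
* §1 **`heightTwistLoc_flat`** — `G_s|_{K₀} = G_{s'}|_{K₀}` (`H_v ≡ 1` on `K₀`: ★ `iwasawaHeight_of_mem_K` through `ι_v(K₀) ⊆ 𝒦.K`); `hIw` in ★ D10's spelling (★ `mem_siegelDeltaLoc_iff_local`).
* §2 **`exists_localFace`** — for every Haar `ν` on `unipDeltaLoc v` and every `h ∈ H_v`:
  `∃ Fn : ℂ → H_v → ℂ`, (`∀ s₀′, 0 < re s₀′ → ∀ h, IsQRationalRegularAt q_v s₀′ (Fn · h)`) ∧ `∀ s, 1 < re s → ∀ h, ∫ y, G_s((w_Δ)_v ↑y h) ∂ν = aNorm 2 χ_v (ν{↑y ∈ K₀}) s · Fn s h`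
  (★ A7-AllS0 at `K₀` + ★ (E10c)); **`integrable_localFace`** — `Integrable (y ↦ G_s((w_Δ)_v ↑y h)) ν` on `1 < re s` (★ (E9)).
These are the letters `hG`, `hGv` of ★ p862168 `eulerFace_of_letters'` at the bad places; the scalar `aNorm_v` is then read by ★ E7′∕E7″ (`K2LiuSiegelNormaliserTwoOfRecord`).
Sources: [KudlaSweet1997, §1]; [HarrisKudlaSweet1996, §1 (1.15)–(1.17), §6 (6.14)–(6.16)]; [Casselman1980, §3 Thm. 3.1]; [Tan1999, §1 p. 166, §3]; [GelbartRogawski1991, §3.1 Prop. 3.1.1].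
HONEST LABEL.  Helper lemmas, count-neutral; `HC_CM` is proved only modulo the 7 printed citations (2 remaining named inputs:
hLiu418 = `stmt-HodgeConjecture-24832`, h413 = `stmt-HodgeConjecture-24833`) until rung 0 closes.
-/

set_option autoImplicit false
set_option linter.dupNamespace false -- the mandated namespace repeats `HodgeConjecture.HodgeConjecture`

noncomputable section

open scoped NNReal ENNReal
open NumberField IsDedekindDomain Matrix MeasureTheory Topology
open Literature.NumberTheory.GaloisRepresentations.IsNonarchimedeanLocalField (residueFieldCard)
open Literature.NumberTheory.Automorphic Literature.NumberTheory.Automorphic.UnitaryGroup Literature.NumberTheory.GaloisRepresentations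
open Literature.NumberTheory.GelbartRogawski1991 Literature.NumberTheory.GelbartRogawski1991.GRConstruction
open Literature.NumberTheory.GelbartRogawski1991.UnitaryDualPair Literature.NumberTheory.GelbartRogawski1991.UnitaryDualPair.LocalSplitting
open Literature.NumberTheory.K2Lit Literature.NumberTheory.K2Lit.SiegelDoubled Literature.NumberTheory.K2Lit.LocalSiegelDoubled
open Literature.NumberTheory.Automorphic.IdeleClassGroup
open Summit.HodgeConjecture.HodgeConjecture.Cruxes.HLiu418.K2LiuQRationalDefs (IsQRationalRegularAt)
open Summit.HodgeConjecture.HodgeConjecture.Cruxes.HLiu418.K2LiuLocalLFactorDefs (aNorm)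
open Summit.HodgeConjecture.HodgeConjecture.Cruxes.HLiu418.K2LiuSiegelUnipotentLocalDefs (unipDeltaLoc)
open Summit.HodgeConjecture.HodgeConjecture.Cruxes.HLiu418.K2LiuA7NormalisedRegularityCMAllS0 (normalisedRegularity_cm_allS0)
open Summit.HodgeConjecture.HodgeConjecture.Cruxes.HLiu418.K2LiuUnipDeltaLocIntegralTransport (exists_value_unipDeltaLoc_of_forall_haar)
open Summit.HodgeConjecture.HodgeConjecture.Cruxes.HLiu418.K2LiuLocalSiegelSectionIntegrable (integrable_weylDelta_mul_unipDeltaLoc_cm)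
open Summit.HodgeConjecture.HodgeConjecture.Cruxes.HLiu418.K2LiuStdFamilyAwayPurityFlat (heightTwistLoc_siegel heightTwistLoc_smooth)
open Summit.HodgeConjecture.HodgeConjecture.Cruxes.HLiu418.K2LiuIwasawaHeightContinuous (iwasawaHeight_of_mem_K)
open Summit.HodgeConjecture.HodgeConjecture.Cruxes.HLiu418.K2LiuSiegelNormaliserTwoOfRecord (norm_localComponent_of_record)

namespace Summit.HodgeConjecture.HodgeConjecture.Cruxes.HLiu418.K2LiuBigCellLocalFace

variable (L : Type) [Field L] [NumberField L] [IsCMField L]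

/-! ## §1 Flatness of the (E6′) local factor on an adapted compact; the Iwasawa letter in ★ D10's spelling (any rank) -/

section Flat

variable {N M n : ℕ} (e : Fin N × Fin M ≃ Fin n)
  (dV : Fin N → L) (hdV : ∀ i, IsCMField.complexConj L (dV i) = dV i) (hdV0 : ∀ i, dV i ≠ 0)
  (dW : Fin M → L) (hdW : ∀ i, IsCMField.complexConj L (dW i) = dW i) (hdW0 : ∀ i, dW i ≠ 0)
  (v : HeightOneSpectrum (𝓞 (Fp L)))

include hdV0 hdW0 in
/-- **the (E6′) local factor is FLAT on an adapted compact**: if `ι_v(K₀) ⊆ 𝒦.K` then `H_v ≡ 1` on `K₀` (★ `iwasawaHeight_of_mem_K`), so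
`H_v(k)^{2(s−s₀)}·b(k) = H_v(k)^{2(s′−s₀)}·b(k)` for `k ∈ K₀`. [cite: Tan1999, §1 p. 166] [cite: HarrisKudlaSweet1996, §1 (1.15)] -/
theorem heightTwistLoc_flat (𝒦 : IwasawaDatum L e dV hdV dW hdW) {K₀ : Subgroup (UnitaryGroup.localPi L (IsCMField.complexConj L) (n + n) (hermD L e dV hdV dW hdW) v)}
    (hK₀ : ∀ u ∈ K₀, locToAdelic L e dV hdV dW hdW v u ∈ 𝒦.K) (s₀ : ℂ) (b : UnitaryGroup.localPi L (IsCMField.complexConj L) (n + n) (hermD L e dV hdV dW hdW) v → ℂ) :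
    ∀ s s' : ℂ, ∀ k ∈ K₀,
      ((modDelta L e dV hdV dW hdW (𝒦.pPart (locToAdelic L e dV hdV dW hdW v k)) : ℝ) : ℂ) ^ (2 * (s - s₀)) * b k =
        ((modDelta L e dV hdV dW hdW (𝒦.pPart (locToAdelic L e dV hdV dW hdW v k)) : ℝ) : ℂ) ^ (2 * (s' - s₀)) * b k := by
  intro s s' k hk
  rw [iwasawaHeight_of_mem_K L e dV hdV hdV0 dW hdW hdW0 𝒦 (hK₀ k hk), Complex.ofReal_one, Complex.one_cpow, Complex.one_cpow]

/-- **the local Iwasawa letter in ★ D10's spelling**: `∀ g, ∃ p ∈ siegelDeltaLoc v, ∃ k ∈ K₀, g = p·k` ⟹ `∀ g, ∃ p, IsSiegelDelta_v p ∧ ∃ k ∈ K₀, g = p·k`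
(★ `mem_siegelDeltaLoc_iff_local`). [cite: HarrisKudlaSweet1996, §1 (1.11)] -/
theorem hIw_local {K₀ : Subgroup (UnitaryGroup.localPi L (IsCMField.complexConj L) (n + n) (hermD L e dV hdV dW hdW) v)}
    (hIw : ∀ g : UnitaryGroup.localPi L (IsCMField.complexConj L) (n + n) (hermD L e dV hdV dW hdW) v, ∃ p ∈ siegelDeltaLoc L e dV hdV dW hdW v, ∃ k ∈ K₀, g = p * k) :
    haveI : Algebra.IsQuadraticExtension (Fp L) L := IsCMField.isQuadraticExtension L
    ∀ g : UnitaryGroup.localPi L (IsCMField.complexConj L) (n + n) (hermD L e dV hdV dW hdW) v,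
      ∃ p, LocalSplitting.IsSiegelDelta (Fp L) L (IsCMField.complexConj L) (complexConj_imagUnit L) (imagUnit_ne_zero L) (imagUnit_mul_self L)
        v n (gramR_isSymm L e dV hdV dW hdW) (hermD_eq_map_gramD L e dV hdV dW hdW) p ∧ ∃ k ∈ K₀, g = p * k := by
  intro g
  obtain ⟨p, hp, k, hk, hg⟩ := hIw g
  exact ⟨p, (mem_siegelDeltaLoc_iff_local L e dV hdV dW hdW v p).1 hp, k, hk, hg⟩

end Flat

/-! ## §2 The local face at the CM datum, `n = 2`, for a `K₀`-flat family of smooth Siegel sections -/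

section Face

variable {N M : ℕ} (e : Fin N × Fin M ≃ Fin 2)
  (dV : Fin N → L) (hdV : ∀ i, IsCMField.complexConj L (dV i) = dV i) (hdV0 : ∀ i, dV i ≠ 0)
  (dW : Fin M → L) (hdW : ∀ i, IsCMField.complexConj L (dW i) = dW i) (hdW0 : ∀ i, dW i ≠ 0)
  (v : HeightOneSpectrum (𝓞 (Fp L)))
  [MeasurableSpace ↥(unipDeltaLoc L e dV hdV dW hdW v)] [BorelSpace ↥(unipDeltaLoc L e dV hdV dW hdW v)] (ν : Measure ↥(unipDeltaLoc L e dV hdV dW hdW v)) [ν.IsHaarMeasure]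
  {K₀ : Subgroup (UnitaryGroup.localPi L (IsCMField.complexConj L) (2 + 2) (hermD L e dV hdV dW hdW) v)}
  (hK₀c : IsCompact (K₀ : Set (UnitaryGroup.localPi L (IsCMField.complexConj L) (2 + 2) (hermD L e dV hdV dW hdW) v)))
  (hK₀o : IsOpen (K₀ : Set (UnitaryGroup.localPi L (IsCMField.complexConj L) (2 + 2) (hermD L e dV hdV dW hdW) v)))
  (hIw : ∀ g : UnitaryGroup.localPi L (IsCMField.complexConj L) (2 + 2) (hermD L e dV hdV dW hdW) v, ∃ p ∈ siegelDeltaLoc L e dV hdV dW hdW v, ∃ k ∈ K₀, g = p * k)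
  (lam : IdeleClassGroup L →ₜ* Circle)
  {G : ℂ → UnitaryGroup.localPi L (IsCMField.complexConj L) (2 + 2) (hermD L e dV hdV dW hdW) v → ℂ}
  (hSieg : haveI : Algebra.IsQuadraticExtension (Fp L) L := IsCMField.isQuadraticExtension L
    ∀ s, IsLocalSiegelSection (Fp L) L (IsCMField.complexConj L) (complexConj_imagUnit L) (imagUnit_ne_zero L) (imagUnit_mul_self L)
      v 2 (gramR_isSymm L e dV hdV dW hdW) (hermD_eq_map_gramD L e dV hdV dW hdW) (fun w => (toHeckeCharacter L lam⁻¹).localComponent w.1) s (G s))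
  (hsm : ∀ s, IsSmooth (Fp L) L (IsCMField.complexConj L) v 2 (G s))

set_option maxHeartbeats 800000 in -- MEASURED class (★ (E10c) p862437: 200k∕400k ✗, 800k ✓; ★ A7-CM: 400k): ★ A7-AllS0 + ★ (E10c) at the K2Lit CM telescope; `have` first, then `exact` (a one-shot `exact` times out even at 3 200 000)
include hdV0 hdW0 hK₀c hK₀o hIw hSieg hsm in
/-- **THE LOCAL BAD-PLACE FACE, VALUE HALF.**  At a place with a compact open Iwasawa `K₀ ≤ H_v` and for a `K₀`-FLAT family `G` of smooth Siegel sections of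
`I_v(s, χ_v)`, `χ = toHeckeCharacter L lam⁻¹` (e.g. (E6′)'s `H_v^{2(s−s₀)}·b` on an adapted `K₀`, §1): there is `Fn : ℂ → H_v → ℂ`, `q_v`-rational in `s` and regular at
every `s₁` with `0 < re s₁`, such that for every `1 < re s` and every `h ∈ H_v`  `∫ y, G_s((w_Δ)_v ↑y h) dν(y) = aNorm 2 χ_v (ν{y | ↑y ∈ K₀}) s · Fn s h` —
★ A7-AllS0 `normalisedRegularity_cm_allS0` at `K₀`, moved to `unipDeltaLoc v` and `(w_Δ)_v = evalPlace v (finPart w_Δ)` by ★ (E10c); `‖χ_v‖ = 1` ★ `norm_localComponent_of_record`.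
[cite: KudlaSweet1997, §1] [cite: HarrisKudlaSweet1996, §6 (6.14)–(6.16)] [cite: Casselman1980, §3 Thm. 3.1] [cite: GelbartRogawski1991, §3.1 Prop. 3.1.1] -/
theorem exists_localFace (hflat : ∀ s s' : ℂ, ∀ k ∈ K₀, G s k = G s' k) :
    ∃ Fn : ℂ → UnitaryGroup.localPi L (IsCMField.complexConj L) (2 + 2) (hermD L e dV hdV dW hdW) v → ℂ,
      (∀ s₁ : ℂ, 0 < s₁.re → ∀ h, IsQRationalRegularAt (residueFieldCard (v.adicCompletion (Fp L))) s₁ (fun s => Fn s h)) ∧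
      ∀ s : ℂ, 1 < s.re → ∀ h : UnitaryGroup.localPi L (IsCMField.complexConj L) (2 + 2) (hermD L e dV hdV dW hdW) v,
        ∫ y : ↥(unipDeltaLoc L e dV hdV dW hdW v),
            G s (UnitaryGroup.evalPlace (Fp L) L (IsCMField.complexConj L) (2 + 2) (hermD L e dV hdV dW hdW) v
                  (UnitaryGroup.finPart (Fp L) L (IsCMField.complexConj L) (2 + 2) (hermD L e dV hdV dW hdW) (SiegelDoubled.weylDelta L e dV hdV dW hdW)) *
                (y : UnitaryGroup.localPi L (IsCMField.complexConj L) (2 + 2) (hermD L e dV hdV dW hdW) v) * h) ∂ν =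
          aNorm (Fp L) L (IsCMField.complexConj L) v 2 (fun w : PlacesOver L v => (toHeckeCharacter L lam⁻¹).localComponent w.1)
              (ν.real {y : ↥(unipDeltaLoc L e dV hdV dW hdW v) | (y : UnitaryGroup.localPi L (IsCMField.complexConj L) (2 + 2) (hermD L e dV hdV dW hdW) v) ∈ K₀}) s *
            Fn s h := by
  haveI : Algebra.IsQuadraticExtension (Fp L) L := IsCMField.isQuadraticExtension L
  refine exists_value_unipDeltaLoc_of_forall_haar L e dV hdV dW hdW v ν G (K₀ : Set _)
    (fun Fn => ∀ s₁ : ℂ, 0 < s₁.re → ∀ h, IsQRationalRegularAt (residueFieldCard (v.adicCompletion (Fp L))) s₁ (fun s => Fn s h))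
    (fun vol s => aNorm (Fp L) L (IsCMField.complexConj L) v 2 (fun w : PlacesOver L v => (toHeckeCharacter L lam⁻¹).localComponent w.1) vol s) ?_
  intro _ _ νN _
  have hA7 := normalisedRegularity_cm_allS0 L e dV hdV hdV0 dW hdW hdW0 v νN (fun w : PlacesOver L v => (toHeckeCharacter L lam⁻¹).localComponent w.1)
      (norm_localComponent_of_record L lam v) K₀ ⟨hK₀c, hK₀o⟩ (hIw_local L e dV hdV dW hdW v hIw) G hSieg hsm hflat
  exact hA7

set_option maxHeartbeats 800000 in -- same MEASURED class (★ (E9)∕(E10c) statements in ★ (E3)'s currency)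
include hdV0 hdW0 hSieg hsm in
/-- **THE LOCAL BAD-PLACE FACE, INTEGRABILITY HALF**: `y ↦ G_s((w_Δ)_v y h)` is `ν`-integrable on `1 < re s` (★ (E9) `integrable_weylDelta_mul_unipDeltaLoc_cm` for the smooth
Siegel section `G_s ∈ I_v(s, χ_v)`). [cite: Casselman1980, §3 Thm. 3.1] [cite: KudlaSweet1997, §1] -/
theorem integrable_localFace {s : ℂ} (hs : 1 < s.re) (h : UnitaryGroup.localPi L (IsCMField.complexConj L) (2 + 2) (hermD L e dV hdV dW hdW) v) :
    Integrable (fun y : ↥(unipDeltaLoc L e dV hdV dW hdW v) =>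
      G s (UnitaryGroup.evalPlace (Fp L) L (IsCMField.complexConj L) (2 + 2) (hermD L e dV hdV dW hdW) v
            (UnitaryGroup.finPart (Fp L) L (IsCMField.complexConj L) (2 + 2) (hermD L e dV hdV dW hdW) (SiegelDoubled.weylDelta L e dV hdV dW hdW)) *
          (y : UnitaryGroup.localPi L (IsCMField.complexConj L) (2 + 2) (hermD L e dV hdV dW hdW) v) * h)) ν := by
  haveI : Algebra.IsQuadraticExtension (Fp L) L := IsCMField.isQuadraticExtension L
  exact integrable_weylDelta_mul_unipDeltaLoc_cm L e dV hdV hdV0 dW hdW hdW0 v ν (norm_localComponent_of_record L lam v) hs (hSieg s) (hsm s) h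

end Face

end Summit.HodgeConjecture.HodgeConjecture.Cruxes.HLiu418.K2LiuBigCellLocalFace

end
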